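/-
Copyright (c) 2026 the pub-hodgecm-mathlib formalisation cell (harness21).  Prover seat hodgecm-mathlib-LH4-p15 (g2), req620 Track A «(D-RAM) FOUR-FRAME» squad
(STAGE-1b, row (2) of the piece `f_{T₊}`, the (β₂) road (R-36) «PURE-CELL LEDGER»; β₂ sub-dealer LH4-p04 (g10) WORD #24 letter ‹TERM.letter.v2›, holder LH4-p15: generator
independence on a sphere cell), 2026-09-05.
-/
import Summits.HodgeConjecture.HodgeConjecture.Theorems.F0P3cDyRamNormFormRayOfTrace               -- ★ p863638 (LH7-p09 (g2)): `norm_sub_norm_eq_of_coords` (the `Θ`-norm in `Fix ρ`-coordinates); brings ★ p862572 `map_sub_div_eq`∕`map_sub_mul_eq`, ★ DEFS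
import Summits.HodgeConjecture.HodgeConjecture.Theorems.F0P3cDyRamDiagonalCellGeneratorChange       -- ★ p862877 (LH4-p19 (g2), K5a): `exists_isOrd_mul_of_presentations` (two generators differ by an order unit)
import Summits.HodgeConjecture.HodgeConjecture.Theorems.F0P3cDyRamDiagonalCellGeneratorIndependence -- ★ p863081 (LH4-p19 (g2), K5c): `v_eq_one_of_isOrd_of_mul_eq_one`
import HarnessLib

/-!
# Crux `H413`, line LH4 «(D-RAM) FOUR-FRAME» — STAGE-1b, row (2), the (β₂) road (R-36), row (ROW-TERM)′: «THE CLASS OF `t` AND THE DIGIT `κ̂` OF A SPHERE-CELL LATTICE DO NOT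
# DEPEND ON THE GENERATOR» — in LH4-p16's (t, κ̂) currency, for ANY cone cell `x₀·𝒪_cc`, with the SHARP order-unit norm estimate
# `|N_Θ ζ − N(p)| ≤ max(|ϖE|^{d−1}|cc|, |cc|·|Θα − α|, |cc|²)` (the trace ideal of ★ p863638 §1)

Cell `hodgecm-mathlib` (D-0151), FLOOR 0, crux item H413 = `stmt-HodgeConjecture-24833`, route of record `HCCMUnconditional`; squad F0∕P3c∕LH4; lane
`--supports stmt-HodgeConjecture-24833 --as helper` (count-neutral; pays NO tier-0 row).  THEOREMS ONLY (no `def`, no instance, no notation, no `sorry`, default heartbeats);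
★-only imports; states NO law; (β₂) stays a HYPOTHESIS.  DATUM-FREE one-field letters: `M` with commuting `ρ`, `Θ` (`ρ` an isometric involution with `Fix ρ = jE(E)`, `Θ` isometric,
`Θ ∘ jE = jE ∘ σ`, `σ` an involution), `|α| ≤ 1`, `ρα ≠ α`, an order parameter `cc` (`ρcc = cc`, `|cc| < 1`, `cc(α − ρα) ≠ 0`), `Θh = h ≠ 0`; a trace bound
`|x + σx| ≤ |ϖ|^{d₁}|x|` on `E` (★ Lit `trace_bound_pow_of_isRamifiedQuadraticDatum`: `d₁ = d − 1`); the deep letter `hdeep` (doubly fixed units `≡ 1 (ϖE^n)` are `Θ`-norms of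
`ρ`-fixed elements) as a binder, as in ★ p863477.

WHY (β₂ WORD #24 ‹TERM.letter.v2›; this seat 00:59:58Z (T-b1); the `hI` letter of LH4-p19's ★ p863833 `cellDiff_eq_zero_of_fibration_reads₃`).  The count of the terminal cell fibres
`levelSet(j, b)` by (class of `t`, digit of `κ̂`) in LH4-p16 (g2)'s coordinates `u₀ := h·x₀Θx₀`, `t := Tr_ρ u₀`, `κ̂ := ρu₀∕t` (★ p863477, ★ p863222); for this to be a map on LATTICES
both invariants must not depend on the generator.  A second generator is `x₀′ = x₀·ζ` with `ζ` a unit of the order `𝒪_cc` (★ K5a `exists_isOrd_mul_of_presentations`), so `u₀′ = u₀·N_Θζ`;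
writing `ζ = jE p + jE q·α` over `Fix ρ` (`|q| ≤ |cc|`, `|p| = 1`) ★ p863638 §1 gives `N_Θζ = N(p) + τ` with `τ` `Θ`-fixed and **`|τ| ≤ max(|ϖE|^{d−1}|cc|, |cc||Θα − α|, |cc|²) =: τ₀`** —
SHARPER than ★ K5a `normTheta_orderUnit_eq`'s `|ϖE|^{m*}` (which is tuned to the diagonal `cc = ϖE^b`; on the sphere `|κ̂| = e^{δ} > 1` amplifies `τ`, and only the sharp bound survives:
at `b = 2 = d` the digit moves by `e^{−3}`, one parity step from `|ϖ|^{2d}`).  Then `t′ = N(p)·t·(1 + θ)` with `θ = Tr_ρ(u₀τ)∕(N(p)·t)` doubly fixed, `|θ| ≤ |κ̂|·τ₀`, and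
`κ̂′ − κ̂ = κ̂·(ρτ − θ)∕(N(p)(1 + θ))`, `|κ̂′ − κ̂| ≤ |κ̂|²·τ₀`.
* §1 `exists_coords_of_isOrd_unit` — `ζ ∈ 𝒪_ccˣ` ⇒ `ζ = jE p + jE q·α`, `|q| ≤ |cc|`, `|p| = 1`; `v_normTheta_sub_le_of_coords` — `|N_Θζ − jE(pσp)| ≤ τ₀` under `h1 h2 h3`.
* §2 `normTheta_gen_letters` — for an order unit `ζ` with `|κ̂|·τ₀ ≤ |ϖE|^n < 1`: ∃ doubly fixed `n₀`, `θ` with `|n₀| = 1`, `n₀ = jE p·Θ(jE p)`, `|θ| ≤ |ϖE|^n`,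
  `t(x₀ζ) = n₀·t(x₀)·(1 + θ)` and `|κ̂(x₀ζ) − κ̂(x₀)| ≤ |κ̂(x₀)|²·τ₀`.
* §3 HEAD `cls_iff_cls_and_v_hatKappa_sub_le_of_presentations` — two presentations `Λ = x₀·𝒪_cc = x₀′·𝒪_cc` (`t(x₀)` a unit, `|κ̂(x₀)|·τ₀ ≤ |ϖE|^n`, `hdeep` at `n`):
  `((∃ c, ρc = c ∧ cΘc = t(x₀)) ↔ (∃ c, ρc = c ∧ cΘc = t(x₀′)))` AND `|κ̂(x₀′) − κ̂(x₀)| ≤ |κ̂(x₀)|²·τ₀` — the `hI` letter of ★ p863833 up to the consumer's rescaling of the digit.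
WHAT IS NOT CLAIMED: the parity upgrade of the digit bound, the fibre transport (★ p863477 ∕ ★ K5-C (6)), any count.
HONEST LABEL.  Count-neutral valuation ∕ order algebra; nothing printed is asserted; no census law is stated; ‹TERM.v2› stays OPEN; `HC_CM` is proved only modulo the 7 printed citations
(2 remaining named inputs: hLiu418 = `stmt-HodgeConjecture-24832`, h413 = `stmt-HodgeConjecture-24833`) until rung 0 closes.
## References
* [Serre1979] J.-P. Serre, *Local Fields*, GTM 67 (1979): Ch. III §3 Prop. 7 (`Tr 𝔭_E^j ⊆ 𝔭_F^{⌊(j+d)∕2⌋}`), Ch. III §6 Prop. 12 (orders `𝒪_E + c𝒪_M`), Ch. V §3 Cor. 3.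
* [Jacobowitz1962] R. Jacobowitz, *Hermitian forms over local fields*, Amer. J. Math. 84 (1962): §4 (dual lattices, gluing).
* [Kottwitz1986BaseChangeUnits] R. E. Kottwitz, *Base change for unit elements of Hecke algebras*, Compositio Math. 60 (1986): §1 pp. 240–241 (fixed-lattice counts).
* [Flicker1998UnitaryFL] Y. Z. Flicker, *Elementary proof of the fundamental lemma for a unitary group*, Canad. J. Math. 50 (1998): p. 84 REMARK (the orders `R + π^jR_E`).
-/

set_option autoImplicit false

noncomputable section

namespace Summit.HodgeConjecture.HodgeConjecture.Cruxes.H413.F0P3cDyRamSphereCellGenerator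

open scoped Valued WithZero
open WithZero
open Summit.HodgeConjecture.HodgeConjecture.Cruxes.H413.F0P3cDyRamToricCensusDefs
open Summit.HodgeConjecture.HodgeConjecture.Cruxes.H413.F0P3cDyRamNormFormRayOfTrace (norm_sub_norm_eq_of_coords)
open Summit.HodgeConjecture.HodgeConjecture.Cruxes.H413.F0P3cDyRamTerminalCellOffShellCardTwo (map_sub_div_eq map_sub_mul_eq)
open Summit.HodgeConjecture.HodgeConjecture.Cruxes.H413.F0P3cDyRamDiagonalCellGeneratorChange (exists_isOrd_mul_of_presentations)
open Summit.HodgeConjecture.HodgeConjecture.Cruxes.H413.F0P3cDyRamDiagonalCellGeneratorIndependence (v_eq_one_of_isOrd_of_mul_eq_one)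

variable {E M : Type} [Field E] [Valued E ℤᵐ⁰] [Field M] [Valued M ℤᵐ⁰] {ρ Θ : M →+* M} {α : M}

/-! ## §1 An order unit in `Fix ρ`-coordinates; the sharp bound on its `Θ`-norm -/

/-- **AN ORDER UNIT IN COORDINATES**: `ζ ∈ 𝒪_cc` with `|ζ| = 1`, `|cc| < 1` ⟹ `ζ = jE p + jE q·α` with `|q| ≤ |cc|` and `|p| = 1` (`q = (ζ − ρζ)∕(α − ρα)`, `p = ζ − qα`, both `ρ`-fixed).
[cite: Serre1979, Ch. III §6 Prop. 12] -/
theorem exists_coords_of_isOrd_unit (hρρ : ∀ x, ρ (ρ x) = x) (hα : ρ α ≠ α) (hα1 : Valued.v α ≤ 1)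
    (jE : E →+* M) (hjiso : ∀ x, Valued.v (jE x) = Valued.v x) (hjfix : ∀ z, ρ z = z ↔ ∃ c, jE c = z)
    {cc : M} (hclt : Valued.v cc < 1) {ζ : M} (hζ : IsOrd ρ α cc ζ) (hζ1 : Valued.v ζ = 1) :
    ∃ p q : E, ζ = jE p + jE q * α ∧ Valued.v q ≤ Valued.v cc ∧ Valued.v p = 1 := by
  have hα0 : α - ρ α ≠ 0 := sub_ne_zero.2 (Ne.symm hα)
  have hvαpos : 0 < Valued.v (α - ρ α) := zero_lt_iff.2 ((Valuation.ne_zero_iff _).2 hα0)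
  set q' : M := (ζ - ρ ζ) / (α - ρ α) with hq'def
  set p' : M := ζ - q' * α with hp'def
  have hρq' : ρ q' = q' := by rw [hq'def]; exact map_sub_div_eq hρρ ζ
  have hρp' : ρ p' = p' := by rw [hp'def, hq'def]; exact map_sub_mul_eq hρρ hα ζ
  obtain ⟨q, hq⟩ := (hjfix q').1 hρq'
  obtain ⟨p, hp⟩ := (hjfix p').1 hρp'
  have hvq : Valued.v q ≤ Valued.v cc := by
    rw [← hjiso, hq, hq'def, Valuation.map_div, div_le_iff₀ hvαpos, ← Valuation.map_mul]
    exact hζ.2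
  have hqα : Valued.v (q' * α) < 1 := by
    rw [Valuation.map_mul, ← hq, hjiso]
    calc Valued.v q * Valued.v α ≤ Valued.v cc * 1 := mul_le_mul' hvq hα1
      _ < 1 := by rw [mul_one]; exact hclt
  have hvp : Valued.v p = 1 := by
    rw [← hjiso, hp, hp'def, sub_eq_add_neg, Valuation.map_add_eq_of_lt_left _ (by rw [Valuation.map_neg, hζ1]; exact hqα), hζ1]
  exact ⟨p, q, by rw [hp, hq, hp'def]; ring, hvq, hvp⟩

/-- **THE SHARP ORDER-UNIT NORM ESTIMATE**: for `ζ = jE p + jE q·α` with `|q| ≤ |cc|`, `|p| ≤ 1`, a trace bound `|x + σx| ≤ |ϖ|^{d₁}|x|` on `E`, `Θ ∘ jE = jE ∘ σ`, `σ` an isometric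
involution, `jE`, `Θ` isometric, `|α| ≤ 1`, and a bound `τ₀` with `|ϖE|^{d₁}·|cc| ≤ τ₀`, `|cc|·|Θα − α| ≤ τ₀`, `|cc|² ≤ τ₀`: **`|ζΘζ − jE(pσp)| ≤ τ₀`** (★ p863638 §1 identity: the
cross term is a TRACE of an element of `cc·𝒪_E`). [cite: Serre1979, Ch. III §3 Prop. 7; §6 Prop. 12] -/
theorem v_normTheta_sub_le_of_coords (hα1 : Valued.v α ≤ 1) (hvΘ : ∀ x, Valued.v (Θ x) = Valued.v x)
    (σ : E →+* E) (hσσ : ∀ x, σ (σ x) = x) (hvσ : ∀ a, Valued.v (σ a) = Valued.v a)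
    (jE : E →+* M) (hjiso : ∀ x, Valued.v (jE x) = Valued.v x) (hΘj : ∀ x, Θ (jE x) = jE (σ x))
    {ϖ : E} {d₁ : ℕ} (htr : ∀ x : E, Valued.v (x + σ x) ≤ Valued.v ϖ ^ d₁ * Valued.v x)
    {cc : M} {τ₀ : ℤᵐ⁰} (h1 : Valued.v (jE ϖ) ^ d₁ * Valued.v cc ≤ τ₀) (h2 : Valued.v cc * Valued.v (Θ α - α) ≤ τ₀) (h3 : Valued.v cc * Valued.v cc ≤ τ₀)
    {p q : E} (hvq : Valued.v q ≤ Valued.v cc) (hvp : Valued.v p ≤ 1) :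
    Valued.v ((jE p + jE q * α) * Θ (jE p + jE q * α) - jE (p * σ p)) ≤ τ₀ := by
  have hD : (jE p + jE q * α) * Θ (jE p + jE q * α) - jE (p * σ p) =
      jE (p * σ q + σ (p * σ q)) * α + jE (p * σ q) * (Θ α - α) + jE (q * σ q) * (α * Θ α) := by
    rw [← norm_sub_norm_eq_of_coords σ hσσ jE hΘj p q, map_mul jE p (σ p), hΘj]
  set x : E := p * σ q with hxdef
  have hvx : Valued.v x ≤ Valued.v cc := by
    rw [hxdef, Valuation.map_mul, hvσ]
    calc Valued.v p * Valued.v q ≤ 1 * Valued.v cc := mul_le_mul' hvp hvq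
      _ = Valued.v cc := one_mul _
  have hT1 : Valued.v (jE (x + σ x) * α) ≤ τ₀ := by
    rw [Valuation.map_mul, hjiso]
    calc Valued.v (x + σ x) * Valued.v α ≤ Valued.v ϖ ^ d₁ * Valued.v x * 1 := mul_le_mul' (htr x) hα1
      _ ≤ Valued.v ϖ ^ d₁ * Valued.v cc := by rw [mul_one]; exact mul_le_mul' le_rfl hvx
      _ = Valued.v (jE ϖ) ^ d₁ * Valued.v cc := by rw [hjiso]
      _ ≤ τ₀ := h1
  have hT2 : Valued.v (jE x * (Θ α - α)) ≤ τ₀ := by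
    rw [Valuation.map_mul, hjiso]
    calc Valued.v x * Valued.v (Θ α - α) ≤ Valued.v cc * Valued.v (Θ α - α) := mul_le_mul' hvx le_rfl
      _ ≤ τ₀ := h2
  have hT3 : Valued.v (jE (q * σ q) * (α * Θ α)) ≤ τ₀ := by
    rw [Valuation.map_mul, hjiso, Valuation.map_mul, hvσ, Valuation.map_mul, hvΘ]
    calc Valued.v q * Valued.v q * (Valued.v α * Valued.v α) ≤ Valued.v cc * Valued.v cc * (1 * 1) :=
          mul_le_mul' (mul_le_mul' hvq hvq) (mul_le_mul' hα1 hα1)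
      _ = Valued.v cc * Valued.v cc := by rw [mul_one, mul_one]
      _ ≤ τ₀ := h3
  rw [hD]
  exact (Valuation.map_add _ _ _).trans (max_le ((Valuation.map_add _ _ _).trans (max_le hT1 hT2)) hT3)

/-! ## §2 The two invariants under `x₀ ↦ x₀·ζ` -/

omit [Valued E ℤᵐ⁰] [Valued M ℤᵐ⁰] in
/-- `u₀(x₀ζ) = u₀(x₀)·N_Θ ζ` (`u₀ = h·x₀Θx₀`). [cite: Jacobowitz1962, §4] -/
theorem normTheta_gen_eq (h x₀ ζ : M) : h * (x₀ * ζ * Θ (x₀ * ζ)) = h * (x₀ * Θ x₀) * (ζ * Θ ζ) := by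
  rw [map_mul]; ring

omit [Field E] [Valued E ℤᵐ⁰] [Valued M ℤᵐ⁰] in
/-- A point of `ρ`-trace `t ≠ 0`: `u₀ = t·ρ(ρu₀∕t)`. [cite: Serre1979, Ch. V §2 Prop. 3] -/
theorem eq_trace_mul_map_div (hρρ : ∀ x, ρ (ρ x) = x) {u₀ : M} (ht : u₀ + ρ u₀ ≠ 0) :
    u₀ = (u₀ + ρ u₀) * ρ (ρ u₀ / (u₀ + ρ u₀)) := by
  rw [map_div₀, hρρ, map_add, hρρ, add_comm (ρ u₀) u₀]; field_simp

omit [Field E] [Valued E ℤᵐ⁰] in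
/-- A point `κ` of `ρ`-trace one has `1 ≤ |κ|`. [cite: Serre1979, Ch. V §2 Prop. 3] -/
theorem one_le_v_of_trace_one (hvρ : ∀ x, Valued.v (ρ x) = Valued.v x) {κ : M} (hκ : κ + ρ κ = 1) : 1 ≤ Valued.v κ := by
  have h := Valuation.map_add Valued.v κ (ρ κ)
  rw [hκ, Valuation.map_one, hvρ, max_self] at h
  exact h

/-- **THE GENERATOR-CHANGE LETTERS**: `ρ`, `Θ` commuting (`ρ` an isometric involution fixing `jE(E)`, `Θ` isometric with `Θ² = 1`), an element `ζ` whose `Θ`-norm is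
`n₀ + τ` with `n₀ = jE p·Θ(jE p)`, `|p| = 1` and `|τ| ≤ τ₀`; the old vertex has `u₀ := h·x₀Θx₀` with `t := Tr_ρ u₀` a UNIT and digit `κ̂ := ρu₀∕t` with `|κ̂|·τ₀ ≤ η < 1`.
THEN there is a doubly fixed `θ`, `|θ| ≤ η`, with `Tr_ρ(u₀′) = n₀·t·(1 + θ)` for `u₀′ := h·(x₀ζ)Θ(x₀ζ)`, and the new digit satisfies `|ρu₀′∕Tr_ρ u₀′ − κ̂| ≤ |κ̂|·|κ̂|·τ₀`.
[cite: Jacobowitz1962, §4] [cite: Serre1979, Ch. III §6 Prop. 12; Ch. V §2 Prop. 3] -/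
theorem normTheta_gen_letters (hρρ : ∀ x, ρ (ρ x) = x) (hvρ : ∀ x, Valued.v (ρ x) = Valued.v x) (hΘΘ : ∀ x, Θ (Θ x) = x) (hΘρ : ∀ x, Θ (ρ x) = ρ (Θ x))
    (hvΘ : ∀ x, Valued.v (Θ x) = Valued.v x)
    (jE : E →+* M) (hjiso : ∀ x, Valued.v (jE x) = Valued.v x) (hρj : ∀ c, ρ (jE c) = jE c)
    {h x₀ ζ τ : M} {p : E} (hΘh : Θ h = h) (hvp : Valued.v p = 1) (hN : ζ * Θ ζ = jE p * Θ (jE p) + τ) {τ₀ η : ℤᵐ⁰} (hτ : Valued.v τ ≤ τ₀)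
    (ht1 : Valued.v (h * (x₀ * Θ x₀) + ρ (h * (x₀ * Θ x₀))) = 1)
    (hκτ : Valued.v (ρ (h * (x₀ * Θ x₀)) / (h * (x₀ * Θ x₀) + ρ (h * (x₀ * Θ x₀)))) * τ₀ ≤ η) (hη : η < 1) :
    ∃ θ : M, ρ θ = θ ∧ Θ θ = θ ∧ Valued.v θ ≤ η ∧
      h * (x₀ * ζ * Θ (x₀ * ζ)) + ρ (h * (x₀ * ζ * Θ (x₀ * ζ))) = jE p * Θ (jE p) * (h * (x₀ * Θ x₀) + ρ (h * (x₀ * Θ x₀))) * (1 + θ) ∧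
      Valued.v (ρ (h * (x₀ * ζ * Θ (x₀ * ζ))) / (h * (x₀ * ζ * Θ (x₀ * ζ)) + ρ (h * (x₀ * ζ * Θ (x₀ * ζ)))) -
          ρ (h * (x₀ * Θ x₀)) / (h * (x₀ * Θ x₀) + ρ (h * (x₀ * Θ x₀)))) ≤
        Valued.v (ρ (h * (x₀ * Θ x₀)) / (h * (x₀ * Θ x₀) + ρ (h * (x₀ * Θ x₀)))) *
          Valued.v (ρ (h * (x₀ * Θ x₀)) / (h * (x₀ * Θ x₀) + ρ (h * (x₀ * Θ x₀)))) * τ₀ := by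
  set u₀ : M := h * (x₀ * Θ x₀) with hu₀
  set t : M := u₀ + ρ u₀ with htdef
  set κ : M := ρ u₀ / t with hκdef
  set n₀ : M := jE p * Θ (jE p) with hn₀
  -- letters of `n₀`, `t`, `κ`
  have hρn₀ : ρ n₀ = n₀ := by rw [hn₀, map_mul, hρj, ← hΘρ, hρj]
  have hΘn₀ : Θ n₀ = n₀ := by rw [hn₀, map_mul, hΘΘ, mul_comm]
  have hn₀1 : Valued.v n₀ = 1 := by rw [hn₀, Valuation.map_mul, hvΘ, hjiso, hvp, mul_one]
  have hn₀0 : n₀ ≠ 0 := fun h0 => by rw [h0, map_zero] at hn₀1; exact zero_ne_one hn₀1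
  have ht0 : t ≠ 0 := fun h0 => by rw [h0, map_zero] at ht1; exact zero_ne_one ht1
  have hρt : ρ t = t := by rw [htdef, map_add, hρρ, add_comm]
  have hΘu₀ : Θ u₀ = u₀ := by rw [hu₀, map_mul, map_mul, hΘh, hΘΘ]; ring
  have hΘt : Θ t = t := by rw [htdef, map_add, hΘρ, hΘu₀]
  have hκtr : κ + ρ κ = 1 := by rw [hκdef, map_div₀, hρρ, hρt, ← add_div, add_comm, ← htdef, div_self ht0]
  have hκ1 : 1 ≤ Valued.v κ := one_le_v_of_trace_one hvρ hκtr
  have hu₀eq : u₀ = t * ρ κ := by rw [hκdef, htdef]; exact eq_trace_mul_map_div hρρ (by rw [← htdef]; exact ht0)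
  have hu₀v : Valued.v u₀ = Valued.v κ := by rw [hu₀eq, Valuation.map_mul, ht1, one_mul, hvρ]
  -- `τ` is `Θ`-fixed
  have hΘτ : Θ τ = τ := by
    have e : τ = ζ * Θ ζ - n₀ := by rw [hN, hn₀]; ring
    rw [e, map_sub, map_mul, hΘΘ, mul_comm (Θ ζ) ζ, hΘn₀]
  -- the new `u₀′ = u₀(n₀ + τ)` and its trace `n₀ t + s`
  have hu' : h * (x₀ * ζ * Θ (x₀ * ζ)) = u₀ * (n₀ + τ) := by rw [normTheta_gen_eq, hN, hn₀]
  set s : M := u₀ * τ + ρ (u₀ * τ) with hsdef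
  have hρs : ρ s = s := by rw [hsdef, map_add, hρρ, add_comm]
  have hΘs : Θ s = s := by rw [hsdef, map_add, map_mul, hΘu₀, hΘτ, hΘρ, map_mul, hΘu₀, hΘτ]
  have hsv : Valued.v s ≤ Valued.v κ * τ₀ := by
    refine (Valuation.map_add _ _ _).trans (max_le ?_ ?_)
    · rw [Valuation.map_mul, hu₀v]; exact mul_le_mul' le_rfl hτ
    · rw [hvρ, Valuation.map_mul, hu₀v]; exact mul_le_mul' le_rfl hτ
  have htr' : h * (x₀ * ζ * Θ (x₀ * ζ)) + ρ (h * (x₀ * ζ * Θ (x₀ * ζ))) = n₀ * t + s := by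
    have e1 : ρ (u₀ * (n₀ + τ)) = ρ u₀ * (n₀ + ρ τ) := by rw [map_mul, map_add, hρn₀]
    have e2 : ρ (u₀ * τ) = ρ u₀ * ρ τ := map_mul ρ u₀ τ
    rw [hu', e1, hsdef, e2, htdef]; ring
  -- `θ := s ∕ (n₀ t)`
  refine ⟨s / (n₀ * t), by rw [map_div₀, hρs, map_mul, hρn₀, hρt], by rw [map_div₀, hΘs, map_mul, hΘn₀, hΘt], ?_, ?_, ?_⟩
  · rw [Valuation.map_div, Valuation.map_mul, hn₀1, ht1, mul_one, div_one]
    exact hsv.trans hκτ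
  · rw [htr']
    field_simp
  · -- the digit: `κ′ − κ = κ·(ρτ − s∕t)∕(n₀(1 + s∕(n₀t)))`
    have hθv : Valued.v (s / (n₀ * t)) < 1 := by
      rw [Valuation.map_div, Valuation.map_mul, hn₀1, ht1, mul_one, div_one]; exact (hsv.trans hκτ).trans_lt hη
    have h1θ : Valued.v (1 + s / (n₀ * t)) = 1 := Valued.v.map_one_add_of_lt hθv
    have h1θ0 : 1 + s / (n₀ * t) ≠ 0 := fun h0 => by rw [h0, map_zero] at h1θ; exact zero_ne_one h1θ
    have hden0 : n₀ * t + s ≠ 0 := by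
      have e : n₀ * t + s = n₀ * t * (1 + s / (n₀ * t)) := by field_simp
      rw [e]; exact mul_ne_zero (mul_ne_zero hn₀0 ht0) h1θ0
    have hnew : ρ (h * (x₀ * ζ * Θ (x₀ * ζ))) / (h * (x₀ * ζ * Θ (x₀ * ζ)) + ρ (h * (x₀ * ζ * Θ (x₀ * ζ)))) = ρ u₀ * (n₀ + ρ τ) / (n₀ * t + s) := by
      rw [htr', hu', map_mul, map_add, hρn₀]
    have hdiff : ρ u₀ * (n₀ + ρ τ) / (n₀ * t + s) - κ = κ * ((ρ τ - s / t) / (n₀ * (1 + s / (n₀ * t)))) := by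
      rw [hκdef]; field_simp; ring
    have hX : Valued.v ((ρ τ - s / t) / (n₀ * (1 + s / (n₀ * t)))) ≤ Valued.v κ * τ₀ := by
      rw [Valuation.map_div Valued.v (ρ τ - s / t) (n₀ * (1 + s / (n₀ * t))), Valuation.map_mul, hn₀1, h1θ, one_mul, div_one]
      refine (Valuation.map_sub _ _ _).trans (max_le ?_ ?_)
      · rw [hvρ]
        calc Valued.v τ ≤ τ₀ := hτ
          _ = 1 * τ₀ := (one_mul _).symm
          _ ≤ Valued.v κ * τ₀ := mul_le_mul' hκ1 le_rfl
      · rw [Valuation.map_div Valued.v s t, ht1, div_one]; exact hsv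
    rw [hnew, hdiff]
    calc Valued.v (κ * ((ρ τ - s / t) / (n₀ * (1 + s / (n₀ * t))))) = Valued.v κ * Valued.v ((ρ τ - s / t) / (n₀ * (1 + s / (n₀ * t)))) :=
          Valuation.map_mul _ _ _
      _ ≤ Valued.v κ * (Valued.v κ * τ₀) := mul_le_mul' le_rfl hX
      _ = Valued.v κ * Valued.v κ * τ₀ := (mul_assoc _ _ _).symm

/-! ## §3 HEAD — class and digit do not depend on the generator -/

/-- **HEAD — «THE CLASS OF `t` AND THE DIGIT `κ̂` DO NOT DEPEND ON THE GENERATOR».**  One-field letters: `ρ` an isometric involution with `Fix ρ = jE(E)`, `Θ` an isometric involution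
commuting with `ρ`, `Θ ∘ jE = jE ∘ σ` (`σ` an isometric involution), `jE` isometric, `|α| ≤ 1`, `ρα ≠ α`; an order parameter `cc` with `|cc| < 1`; the trace bound
`|x + σx| ≤ |ϖ|^{d₁}|x|` on `E` and a bound `τ₀` with `|ϖE|^{d₁}|cc| ≤ τ₀`, `|cc||Θα − α| ≤ τ₀`, `|cc|² ≤ τ₀`; `Θh = h`; two presentations `Λ = x₀·𝒪_cc = x₀′·𝒪_cc` (`x₀ ≠ 0`);
the old vertex has `t(x₀)` a unit and `|κ̂(x₀)|·τ₀ ≤ η < 1`; the deep letter `hdeep` at `η`.  THEN the `t`-classes agree — `(∃ c, ρc = c ∧ cΘc = t(x₀)) ↔ (∃ c, ρc = c ∧ cΘc = t(x₀′))` —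
and the digits are close: `|κ̂(x₀′) − κ̂(x₀)| ≤ |κ̂(x₀)|²·τ₀`. [cite: Kottwitz1986BaseChangeUnits, §1 pp. 240–241] [cite: Jacobowitz1962, §4] [cite: Serre1979, Ch. III §3 Prop. 7; §6 Prop. 12] -/
theorem cls_iff_cls_and_v_hatKappa_sub_le_of_presentations
    (hρρ : ∀ x, ρ (ρ x) = x) (hvρ : ∀ x, Valued.v (ρ x) = Valued.v x) (hα : ρ α ≠ α) (hα1 : Valued.v α ≤ 1)
    (hΘΘ : ∀ x, Θ (Θ x) = x) (hΘρ : ∀ x, Θ (ρ x) = ρ (Θ x)) (hvΘ : ∀ x, Valued.v (Θ x) = Valued.v x)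
    (σ : E →+* E) (hσσ : ∀ x, σ (σ x) = x) (hvσ : ∀ a, Valued.v (σ a) = Valued.v a)
    (jE : E →+* M) (hjiso : ∀ x, Valued.v (jE x) = Valued.v x) (hΘj : ∀ x, Θ (jE x) = jE (σ x)) (hjfix : ∀ z, ρ z = z ↔ ∃ c, jE c = z)
    {ϖ : E} {d₁ : ℕ} (htr : ∀ x : E, Valued.v (x + σ x) ≤ Valued.v ϖ ^ d₁ * Valued.v x)
    {cc : M} (hclt : Valued.v cc < 1) {τ₀ η : ℤᵐ⁰}
    (h1 : Valued.v (jE ϖ) ^ d₁ * Valued.v cc ≤ τ₀) (h2 : Valued.v cc * Valued.v (Θ α - α) ≤ τ₀) (h3 : Valued.v cc * Valued.v cc ≤ τ₀) (hη : η < 1)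
    (hdeep : ∀ u : M, ρ u = u → Θ u = u → Valued.v (u - 1) ≤ η → ∃ c : M, ρ c = c ∧ c * Θ c = u)
    {h : M} (hΘh : Θ h = h) {Λ : AddSubgroup M} {x₀ x₀' : M} (hx₀ : x₀ ≠ 0)
    (hΛx : ∀ x, x ∈ Λ ↔ ∃ ζ, IsOrd ρ α cc ζ ∧ x = x₀ * ζ) (hΛx' : ∀ x, x ∈ Λ ↔ ∃ ζ, IsOrd ρ α cc ζ ∧ x = x₀' * ζ)
    (ht1 : Valued.v (h * (x₀ * Θ x₀) + ρ (h * (x₀ * Θ x₀))) = 1)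
    (hκτ : Valued.v (ρ (h * (x₀ * Θ x₀)) / (h * (x₀ * Θ x₀) + ρ (h * (x₀ * Θ x₀)))) * τ₀ ≤ η) :
    ((∃ c : M, ρ c = c ∧ c * Θ c = h * (x₀ * Θ x₀) + ρ (h * (x₀ * Θ x₀))) ↔
        (∃ c : M, ρ c = c ∧ c * Θ c = h * (x₀' * Θ x₀') + ρ (h * (x₀' * Θ x₀')))) ∧
      Valued.v (ρ (h * (x₀' * Θ x₀')) / (h * (x₀' * Θ x₀') + ρ (h * (x₀' * Θ x₀'))) -
          ρ (h * (x₀ * Θ x₀)) / (h * (x₀ * Θ x₀) + ρ (h * (x₀ * Θ x₀)))) ≤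
        Valued.v (ρ (h * (x₀ * Θ x₀)) / (h * (x₀ * Θ x₀) + ρ (h * (x₀ * Θ x₀)))) *
          Valued.v (ρ (h * (x₀ * Θ x₀)) / (h * (x₀ * Θ x₀) + ρ (h * (x₀ * Θ x₀)))) * τ₀ := by
  have hρj : ∀ c : E, ρ (jE c) = jE c := fun c => (hjfix _).2 ⟨c, rfl⟩
  -- the order unit `ζ` with `x₀′ = x₀ζ`
  obtain ⟨ζ, ζ', hζ, hζ', rfl, hζζ'⟩ := exists_isOrd_mul_of_presentations hx₀ hΛx hΛx'
  have hζ1 : Valued.v ζ = 1 := v_eq_one_of_isOrd_of_mul_eq_one hζ hζ' hζζ'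
  -- its coordinates and the sharp norm estimate
  obtain ⟨p, q, hζpq, hvq, hvp⟩ := exists_coords_of_isOrd_unit hρρ hα hα1 jE hjiso hjfix hclt hζ hζ1
  set τ : M := ζ * Θ ζ - jE p * Θ (jE p) with hτdef
  have hN : ζ * Θ ζ = jE p * Θ (jE p) + τ := by rw [hτdef]; ring
  have hτ : Valued.v τ ≤ τ₀ := by
    have e : τ = (jE p + jE q * α) * Θ (jE p + jE q * α) - jE (p * σ p) := by rw [hτdef, ← hζpq, map_mul, hΘj]
    rw [e]; exact v_normTheta_sub_le_of_coords hα1 hvΘ σ hσσ hvσ jE hjiso hΘj htr h1 h2 h3 hvq hvp.le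
  obtain ⟨θ, hρθ, hΘθ, hθη, htr', hdig⟩ := normTheta_gen_letters hρρ hvρ hΘΘ hΘρ hvΘ jE hjiso hρj hΘh hvp hN hτ ht1 hκτ hη
  refine ⟨?_, hdig⟩
  -- the class: `t′ = N_Θ(jE p)·t·N_Θ(e)` with `eΘe = 1 + θ`, `ρe = e`
  obtain ⟨e, hρe, he⟩ := hdeep (1 + θ) (by rw [map_add, map_one, hρθ]) (by rw [map_add, map_one, hΘθ]) (by rw [add_sub_cancel_left]; exact hθη)
  have hp0 : jE p ≠ 0 := fun h0 => by
    have : Valued.v (jE p) = 0 := by rw [h0, map_zero]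
    rw [hjiso, hvp] at this; exact one_ne_zero this
  have he0 : e ≠ 0 := fun h0 => by
    have hθ1 : Valued.v θ < 1 := hθη.trans_lt hη
    have h1 : Valued.v (1 + θ) = 1 := Valued.v.map_one_add_of_lt hθ1
    rw [← he, h0, zero_mul, map_zero] at h1; exact zero_ne_one h1
  rw [htr', ← he]
  constructor
  · rintro ⟨c, hρc, hc⟩
    refine ⟨c * (jE p * e), by rw [map_mul, map_mul, hρc, hρj, hρe], ?_⟩
    rw [← hc, map_mul, map_mul]; ring
  · rintro ⟨c', hρc', hc'⟩
    refine ⟨c' / (jE p * e), by rw [map_div₀, map_mul, hρc', hρj, hρe], ?_⟩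
    have hpe : jE p * e ≠ 0 := mul_ne_zero hp0 he0
    have hΘpe : Θ (jE p * e) ≠ 0 := (map_ne_zero Θ).2 hpe
    rw [map_div₀, div_mul_div_comm, hc', div_eq_iff (mul_ne_zero hpe hΘpe), map_mul Θ (jE p) e]
    ring

end Summit.HodgeConjecture.HodgeConjecture.Cruxes.H413.F0P3cDyRamSphereCellGenerator

end
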